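/-
Origin: expansion seat `prover-pub-hodgecm-mc-sinst-1-g3-0`, handover #1208 2026-08-20T04:43Z md5 cdf7ab268622 (431 l.) NEW additive drop-alone leaf after #1207 + RUN-37 ThetaAdelicSideInstance; continuity of the four discrepancy pull-backs from sign facts / GoodCtx, slotTypeVec, archLineDatumOfReadOff (= (F1) archLineDatumOf with hμ₀ discharged, hμ₁₂₃ := Δ-identities); install AFTER #1207; drop alone on bounce (and with #1207); NAME LIST: HodgeCM.Model.ArchSideTerm.archLineDatumOfReadOff · HodgeCM.Model.ArchSideTerm.continuous_slotChi₀ · HodgeCM.Model.ArchSideTerm.nWOf_eq_of_goodCtx) (`HOME/mc/pub-hodgecm-mc-sinst-1-g3/stage/HodgeCM/Model/ArchLineSlotTypeCont.lean`, md5 cdf7ab268622, 431 lines);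
landed by the gen-15 packager (p-g15) in gate run 41 as `HodgeCM/Model/ArchLineSlotTypeCont.lean` (verbatim).
-/
/-
Origin: speedrun cell pub-hodgecm, MODEL-CONSTRUCTION sub-cell, lineage mc-sinst-1 (S-instance constructor, BINDER-OWNERS row 5 `S`),
seat prover-pub-hodgecm-mc-sinst-1-g3-0 (gen 3), 2026-08-20.  Target in PKG: `HodgeCM/Model/ArchLineSlotTypeCont.lean`
(NEW additive drop-alone leaf; RUN 41+ material; imports `Model/ArchLineSlotType` (sinst-1 #1207) and `Model/ThetaAdelicSideInstance` (#1201)).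
KERNEL only: 0 records / named facts / cites, 0 proof holes; intended closure {propext, Classical.choice, Quot.sound}.
-/
import Summits.HodgeConjecture.HodgeCM.Model.ArchLineSlotType_2
import Summits.HodgeConjecture.HodgeCM.Model.ThetaAdelicSideInstance

/-!
# The continuity input of `ArchLineSlotType`: the four see-saw discrepancy characters are continuous under plane-definiteness at `ι₁`

`Model/ArchLineSlotType` reads the archimedean types of the four line slots off the characters `slotChiₖ · cₖ` GIVEN their continuity.
Here that input is discharged from the installed tree twins: the discrepancy characters `cmLineChar₀/₁`, `cmConjLineChar₀/₁` of
`UnitaryDualPairSeesawCMLinesCollapse` are `charV₃₄ · char₃`, `char₄` (resp. their conjugated-plane instances), continuous by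
`UnitaryDualPairSeesawConjMajorants.continuous_charV₃₄/char₃/char₄` ([Weil1964, n° 41 Thm 6]) once Weil majorants of the big pair and of
the two line pairs are supplied — which `UnitaryDualPairSeesawCMLines(Conj)Majorants` does from SIGN FACTS: `V` of signature `(N−1,1)` through
`ι₁` and definite elsewhere (for `HermSpace3`: `frameD_sign_ι₁'`, `frameD_sign_of_ne`) and the FIRST plane `diag(dW)` definite through `ι₁`
(`h₁W` — under any good context, `ArchSideTerm.dW_definite_of_goodCtx` of #1201).

* §1 `continuous_cmLineChar₀/₁_of_signs`, `continuous_cmConjLineChar₀/₁_of_signs` (CM data of any rank);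
* §2 for the S pin: `continuous_slotChi₀…₃` (from `h₁W`), `continuous_slotChi₀…₃_mul` (with any continuous eigen-character),
  `…_of_goodCtx`; so `slotType`/`nWOf` of `ArchLineSlotType` are unconditional under `GoodCtx`.

Nothing here is a claim of PerL/QW8; nothing is cited as a fact.
-/

set_option autoImplicit false

noncomputable section

open scoped Matrix NumberField
open Literature.NumberTheory.Automorphic Literature.NumberTheory.Weil1964
open Literature.NumberTheory.GelbartRogawski1991.UnitaryDualPair
open HodgeCM.Adelic HodgeCM.PerL34

namespace HodgeCM.Model.ArchSideTerm

/-! ## §1 CM data of any rank: the discrepancy characters are continuous from sign facts -/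

section CMGeneric

variable (L : Type) [Field L] [NumberField L] [NumberField.IsCMField L] {N n n₁ : ℕ}
  (e : Fin N × Fin 2 ≃ Fin n) (e₁ : Fin N × Fin 1 ≃ Fin n₁)
variable (dV : Fin N → L) (hdV : ∀ i, NumberField.IsCMField.complexConj L (dV i) = dV i) (hdV0 : ∀ i, dV i ≠ 0)
variable (a : Fin 2 → L) (ha : ∀ i, NumberField.IsCMField.complexConj L (a i) = a i) (ha0 : ∀ i, a i ≠ 0)
variable (hGR : (cmSplittingDatum L e dV hdV hdV0 a ha ha0).CompatibleSplitting)

section Plane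

variable
  (hGR₀ : (cmSplittingDatum L e₁ dV hdV hdV0 (lineVec L (a 0)) (fun _ => ha 0) (fun _ => ha0 0)).CompatibleSplitting)
  (hGR₁ : (cmSplittingDatum L e₁ dV hdV hdV0 (lineVec L (a 1)) (fun _ => ha 1) (fun _ => ha0 1)).CompatibleSplitting)

/-- **`χ₀ = (λ_V′ ∘ pr₁)·(λ₃ ∘ pr₂)` is continuous** from the sign facts (`V` of signature `(N−1,1)` at `ι₁`, definite elsewhere; the plane
`diag(a)` definite at `ι₁`). -/
theorem continuous_cmLineChar₀_of_signs (ι₁ : L →+* ℂ)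
    (h₁V : ∃ i₀ : Fin N, (∀ i, i ≠ i₀ → 0 < (ι₁ (dV i)).re) ∨ ∀ i, i ≠ i₀ → (ι₁ (dV i)).re < 0)
    (h₁W : (∀ j, 0 < (ι₁ (a j)).re) ∨ ∀ j, (ι₁ (a j)).re < 0)
    (hV : ∀ τ : L →+* ℂ, NumberField.InfinitePlace.mk τ ≠ NumberField.InfinitePlace.mk ι₁ →
      (∀ i, 0 < (τ (dV i)).re) ∨ ∀ i, (τ (dV i)).re < 0) :
    Continuous fun p => ((cmLineChar₀ L e e₁ dV hdV hdV0 a ha ha0 hGR hGR₀ hGR₁ p : ℂˣ) : ℂ) :=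
  ((continuous_charV₃₄ (↥(NumberField.maximalRealSubfield L)) L (NumberField.IsCMField.complexConj L) N 1 1 e e₁ e₁ (Matrix.diagonal dV)
    (Matrix.diagonal a) (Matrix.diagonal (lineVec L (a 0))) (Matrix.diagonal (lineVec L (a 1)))
    (complexConj_imagUnit L) (imagUnit_ne_zero L) (imagUnit_mul_self L)
    (realDiagonal_isSymm L dV hdV) (realDiagonal_isSymm L a ha)
    (realDiagonal_isSymm L (lineVec L (a 0)) fun _ => ha 0) (realDiagonal_isSymm L (lineVec L (a 1)) fun _ => ha 1)
    (isUnit_det_realDiagonal L dV hdV hdV0) (isUnit_det_realDiagonal L a ha ha0)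
    (isUnit_det_realDiagonal L (lineVec L (a 0)) (fun _ => ha 0) fun _ => ha0 0)
    (isUnit_det_realDiagonal L (lineVec L (a 1)) (fun _ => ha 1) fun _ => ha0 1)
    ((Matrix.isUnit_iff_isUnit_det _).1
      (isUnit_kronecker_map (↥(NumberField.maximalRealSubfield L)) N (isUnit_det_realDiagonal L dV hdV hdV0)
        (isUnit_det_realDiagonal L a ha ha0)))
    (realDiagonal_map L dV hdV).symm (realDiagonal_map L a ha).symm
    (realDiagonal_map L (lineVec L (a 0)) fun _ => ha 0).symm (realDiagonal_map L (lineVec L (a 1)) fun _ => ha 1).symm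
    (coe_one_GL_eq_map L (NumberField.AdeleRing (𝓞 L) L) (Fin (1 + 1))) (adelicIsometry_one_lineVec L a)
    (coe_one_GL_eq_map (↥(NumberField.maximalRealSubfield L)) (NumberField.AdeleRing (𝓞 ↥(NumberField.maximalRealSubfield L)) ↥(NumberField.maximalRealSubfield L))
      (Fin N × Fin (1 + 1)))
    (gramIntertwiner_one_lineVec L a ha (realDiagonal L dV hdV))
    (splittingOf_isCompatible _ _ _ _ _ _ _ _ _ _ _ _ _ _ _ _ _ hGR)
    (splittingOf_isCompatible _ _ _ _ _ _ _ _ _ _ _ _ _ _ _ _ _ hGR₀)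
    (splittingOf_isCompatible _ _ _ _ _ _ _ _ _ _ _ _ _ _ _ _ _ hGR₁)
    (hasThetaMajorants_cmPairSplitting_of_signs_two L e dV hdV hdV0 a ha ha0 ι₁ hGR h₁V h₁W hV)
    (hasThetaMajorants_omega_pairSmall₁_lineVec_of_signs L e₁ dV hdV hdV0 (a 0) (ha 0) (ha0 0) hGR₀ ι₁ h₁V hV)
    (hasThetaMajorants_omega_pairSmall₂_lineVec_of_signs L e₁ dV hdV hdV0 (a 1) (ha 1) (ha0 1) hGR₁ ι₁ h₁V hV)).comp
      continuous_fst).mul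
  ((continuous_char₃ (↥(NumberField.maximalRealSubfield L)) L (NumberField.IsCMField.complexConj L) N 1 1 e e₁ e₁ (Matrix.diagonal dV)
    (Matrix.diagonal a) (Matrix.diagonal (lineVec L (a 0))) (Matrix.diagonal (lineVec L (a 1)))
    (complexConj_imagUnit L) (imagUnit_ne_zero L) (imagUnit_mul_self L)
    (realDiagonal_isSymm L dV hdV) (realDiagonal_isSymm L a ha)
    (realDiagonal_isSymm L (lineVec L (a 0)) fun _ => ha 0) (realDiagonal_isSymm L (lineVec L (a 1)) fun _ => ha 1)
    (isUnit_det_realDiagonal L dV hdV hdV0) (isUnit_det_realDiagonal L a ha ha0)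
    (isUnit_det_realDiagonal L (lineVec L (a 0)) (fun _ => ha 0) fun _ => ha0 0)
    (isUnit_det_realDiagonal L (lineVec L (a 1)) (fun _ => ha 1) fun _ => ha0 1)
    ((Matrix.isUnit_iff_isUnit_det _).1
      (isUnit_kronecker_map (↥(NumberField.maximalRealSubfield L)) N (isUnit_det_realDiagonal L dV hdV hdV0)
        (isUnit_det_realDiagonal L a ha ha0)))
    (realDiagonal_map L dV hdV).symm (realDiagonal_map L a ha).symm
    (realDiagonal_map L (lineVec L (a 0)) fun _ => ha 0).symm (realDiagonal_map L (lineVec L (a 1)) fun _ => ha 1).symm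
    (coe_one_GL_eq_map L (NumberField.AdeleRing (𝓞 L) L) (Fin (1 + 1))) (adelicIsometry_one_lineVec L a)
    (coe_one_GL_eq_map (↥(NumberField.maximalRealSubfield L)) (NumberField.AdeleRing (𝓞 ↥(NumberField.maximalRealSubfield L)) ↥(NumberField.maximalRealSubfield L))
      (Fin N × Fin (1 + 1)))
    (gramIntertwiner_one_lineVec L a ha (realDiagonal L dV hdV))
    (splittingOf_isCompatible _ _ _ _ _ _ _ _ _ _ _ _ _ _ _ _ _ hGR)
    (splittingOf_isCompatible _ _ _ _ _ _ _ _ _ _ _ _ _ _ _ _ _ hGR₀)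
    (splittingOf_isCompatible _ _ _ _ _ _ _ _ _ _ _ _ _ _ _ _ _ hGR₁)
    (hasThetaMajorants_cmPairSplitting_of_signs_two L e dV hdV hdV0 a ha ha0 ι₁ hGR h₁V h₁W hV)
    (hasThetaMajorants_omega_pairSmall₁_lineVec_of_signs L e₁ dV hdV hdV0 (a 0) (ha 0) (ha0 0) hGR₀ ι₁ h₁V hV)
    (hasThetaMajorants_omega_pairSmall₂_lineVec_of_signs L e₁ dV hdV hdV0 (a 1) (ha 1) (ha0 1) hGR₁ ι₁ h₁V hV)).comp
      continuous_snd)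

/-- **`χ₁ = λ₄ ∘ pr₂` is continuous** from the same sign facts. -/
theorem continuous_cmLineChar₁_of_signs (ι₁ : L →+* ℂ)
    (h₁V : ∃ i₀ : Fin N, (∀ i, i ≠ i₀ → 0 < (ι₁ (dV i)).re) ∨ ∀ i, i ≠ i₀ → (ι₁ (dV i)).re < 0)
    (h₁W : (∀ j, 0 < (ι₁ (a j)).re) ∨ ∀ j, (ι₁ (a j)).re < 0)
    (hV : ∀ τ : L →+* ℂ, NumberField.InfinitePlace.mk τ ≠ NumberField.InfinitePlace.mk ι₁ →
      (∀ i, 0 < (τ (dV i)).re) ∨ ∀ i, (τ (dV i)).re < 0) :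
    Continuous fun p => ((cmLineChar₁ L e e₁ dV hdV hdV0 a ha ha0 hGR hGR₀ hGR₁ p : ℂˣ) : ℂ) :=
  (continuous_char₄ (↥(NumberField.maximalRealSubfield L)) L (NumberField.IsCMField.complexConj L) N 1 1 e e₁ e₁ (Matrix.diagonal dV)
    (Matrix.diagonal a) (Matrix.diagonal (lineVec L (a 0))) (Matrix.diagonal (lineVec L (a 1)))
    (complexConj_imagUnit L) (imagUnit_ne_zero L) (imagUnit_mul_self L)
    (realDiagonal_isSymm L dV hdV) (realDiagonal_isSymm L a ha)
    (realDiagonal_isSymm L (lineVec L (a 0)) fun _ => ha 0) (realDiagonal_isSymm L (lineVec L (a 1)) fun _ => ha 1)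
    (isUnit_det_realDiagonal L dV hdV hdV0) (isUnit_det_realDiagonal L a ha ha0)
    (isUnit_det_realDiagonal L (lineVec L (a 0)) (fun _ => ha 0) fun _ => ha0 0)
    (isUnit_det_realDiagonal L (lineVec L (a 1)) (fun _ => ha 1) fun _ => ha0 1)
    ((Matrix.isUnit_iff_isUnit_det _).1
      (isUnit_kronecker_map (↥(NumberField.maximalRealSubfield L)) N (isUnit_det_realDiagonal L dV hdV hdV0)
        (isUnit_det_realDiagonal L a ha ha0)))
    (realDiagonal_map L dV hdV).symm (realDiagonal_map L a ha).symm
    (realDiagonal_map L (lineVec L (a 0)) fun _ => ha 0).symm (realDiagonal_map L (lineVec L (a 1)) fun _ => ha 1).symm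
    (coe_one_GL_eq_map L (NumberField.AdeleRing (𝓞 L) L) (Fin (1 + 1))) (adelicIsometry_one_lineVec L a)
    (coe_one_GL_eq_map (↥(NumberField.maximalRealSubfield L)) (NumberField.AdeleRing (𝓞 ↥(NumberField.maximalRealSubfield L)) ↥(NumberField.maximalRealSubfield L))
      (Fin N × Fin (1 + 1)))
    (gramIntertwiner_one_lineVec L a ha (realDiagonal L dV hdV))
    (splittingOf_isCompatible _ _ _ _ _ _ _ _ _ _ _ _ _ _ _ _ _ hGR)
    (splittingOf_isCompatible _ _ _ _ _ _ _ _ _ _ _ _ _ _ _ _ _ hGR₀)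
    (splittingOf_isCompatible _ _ _ _ _ _ _ _ _ _ _ _ _ _ _ _ _ hGR₁)
    (hasThetaMajorants_cmPairSplitting_of_signs_two L e dV hdV hdV0 a ha ha0 ι₁ hGR h₁V h₁W hV)
    (hasThetaMajorants_omega_pairSmall₁_lineVec_of_signs L e₁ dV hdV hdV0 (a 0) (ha 0) (ha0 0) hGR₀ ι₁ h₁V hV)
    (hasThetaMajorants_omega_pairSmall₂_lineVec_of_signs L e₁ dV hdV hdV0 (a 1) (ha 1) (ha0 1) hGR₁ ι₁ h₁V hV)).comp
      continuous_snd

end Plane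

section ConjPlane

variable (b : Fin 2 → L) (hb : ∀ i, NumberField.IsCMField.complexConj L (b i) = b i) (hb0 : ∀ i, b i ≠ 0) (g₀ : GL (Fin 2) L)
  (hg₀ : ((g₀ : Matrix (Fin 2) (Fin 2) L).map (NumberField.IsCMField.complexConj L : L →+* L))ᵀ * Matrix.diagonal a *
    (g₀ : Matrix (Fin 2) (Fin 2) L) = Matrix.diagonal b)
variable
  (hGR₀ : (cmSplittingDatum L e₁ dV hdV hdV0 (lineVec L (b 0)) (fun _ => hb 0) (fun _ => hb0 0)).CompatibleSplitting)
  (hGR₁ : (cmSplittingDatum L e₁ dV hdV hdV0 (lineVec L (b 1)) (fun _ => hb 1) (fun _ => hb0 1)).CompatibleSplitting)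

/-- **`χ₀′` (conjugated plane) is continuous** from the sign facts of `V` and of the FIRST plane `diag(a)` at `ι₁`. -/
theorem continuous_cmConjLineChar₀_of_signs (ι₁ : L →+* ℂ)
    (h₁V : ∃ i₀ : Fin N, (∀ i, i ≠ i₀ → 0 < (ι₁ (dV i)).re) ∨ ∀ i, i ≠ i₀ → (ι₁ (dV i)).re < 0)
    (h₁W : (∀ j, 0 < (ι₁ (a j)).re) ∨ ∀ j, (ι₁ (a j)).re < 0)
    (hV : ∀ τ : L →+* ℂ, NumberField.InfinitePlace.mk τ ≠ NumberField.InfinitePlace.mk ι₁ →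
      (∀ i, 0 < (τ (dV i)).re) ∨ ∀ i, (τ (dV i)).re < 0) :
    Continuous fun p => ((cmConjLineChar₀ L e e₁ dV hdV hdV0 a ha ha0 b hb hb0 g₀ hg₀ hGR hGR₀ hGR₁ p : ℂˣ) : ℂ) :=
  ((continuous_charV₃₄ (↥(NumberField.maximalRealSubfield L)) L (NumberField.IsCMField.complexConj L) N 1 1 e e₁ e₁ (Matrix.diagonal dV)
    (Matrix.diagonal a) (Matrix.diagonal (lineVec L (b 0))) (Matrix.diagonal (lineVec L (b 1)))
    (complexConj_imagUnit L) (imagUnit_ne_zero L) (imagUnit_mul_self L)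
    (realDiagonal_isSymm L dV hdV) (realDiagonal_isSymm L a ha)
    (realDiagonal_isSymm L (lineVec L (b 0)) fun _ => hb 0) (realDiagonal_isSymm L (lineVec L (b 1)) fun _ => hb 1)
    (isUnit_det_realDiagonal L dV hdV hdV0) (isUnit_det_realDiagonal L a ha ha0)
    (isUnit_det_realDiagonal L (lineVec L (b 0)) (fun _ => hb 0) fun _ => hb0 0)
    (isUnit_det_realDiagonal L (lineVec L (b 1)) (fun _ => hb 1) fun _ => hb0 1)
    ((Matrix.isUnit_iff_isUnit_det _).1
      (isUnit_kronecker_map (↥(NumberField.maximalRealSubfield L)) N (isUnit_det_realDiagonal L dV hdV hdV0)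
        (isUnit_det_realDiagonal L a ha ha0)))
    (realDiagonal_map L dV hdV).symm (realDiagonal_map L a ha).symm
    (realDiagonal_map L (lineVec L (b 0)) fun _ => hb 0).symm (realDiagonal_map L (lineVec L (b 1)) fun _ => hb 1).symm
    (Literature.NumberTheory.Automorphic.val_toAdeleGL L g₀) (adelicIsometry_conj L a b g₀ hg₀) (coe_gramConj L a ha ha0 b hb hb0)
    (gramIntertwiner_conj L a ha ha0 b hb hb0 (realDiagonal L dV hdV))
    (splittingOf_isCompatible _ _ _ _ _ _ _ _ _ _ _ _ _ _ _ _ _ hGR)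
    (splittingOf_isCompatible _ _ _ _ _ _ _ _ _ _ _ _ _ _ _ _ _ hGR₀)
    (splittingOf_isCompatible _ _ _ _ _ _ _ _ _ _ _ _ _ _ _ _ _ hGR₁)
    (hasThetaMajorants_cmPairSplitting_of_signs_two L e dV hdV hdV0 a ha ha0 ι₁ hGR h₁V h₁W hV)
    (hasThetaMajorants_omega_pairSmall₁_lineVec_of_signs L e₁ dV hdV hdV0 (b 0) (hb 0) (hb0 0) hGR₀ ι₁ h₁V hV)
    (hasThetaMajorants_omega_pairSmall₂_lineVec_of_signs L e₁ dV hdV hdV0 (b 1) (hb 1) (hb0 1) hGR₁ ι₁ h₁V hV)).comp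
      continuous_fst).mul
  ((continuous_char₃ (↥(NumberField.maximalRealSubfield L)) L (NumberField.IsCMField.complexConj L) N 1 1 e e₁ e₁ (Matrix.diagonal dV)
    (Matrix.diagonal a) (Matrix.diagonal (lineVec L (b 0))) (Matrix.diagonal (lineVec L (b 1)))
    (complexConj_imagUnit L) (imagUnit_ne_zero L) (imagUnit_mul_self L)
    (realDiagonal_isSymm L dV hdV) (realDiagonal_isSymm L a ha)
    (realDiagonal_isSymm L (lineVec L (b 0)) fun _ => hb 0) (realDiagonal_isSymm L (lineVec L (b 1)) fun _ => hb 1)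
    (isUnit_det_realDiagonal L dV hdV hdV0) (isUnit_det_realDiagonal L a ha ha0)
    (isUnit_det_realDiagonal L (lineVec L (b 0)) (fun _ => hb 0) fun _ => hb0 0)
    (isUnit_det_realDiagonal L (lineVec L (b 1)) (fun _ => hb 1) fun _ => hb0 1)
    ((Matrix.isUnit_iff_isUnit_det _).1
      (isUnit_kronecker_map (↥(NumberField.maximalRealSubfield L)) N (isUnit_det_realDiagonal L dV hdV hdV0)
        (isUnit_det_realDiagonal L a ha ha0)))
    (realDiagonal_map L dV hdV).symm (realDiagonal_map L a ha).symm
    (realDiagonal_map L (lineVec L (b 0)) fun _ => hb 0).symm (realDiagonal_map L (lineVec L (b 1)) fun _ => hb 1).symm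
    (Literature.NumberTheory.Automorphic.val_toAdeleGL L g₀) (adelicIsometry_conj L a b g₀ hg₀) (coe_gramConj L a ha ha0 b hb hb0)
    (gramIntertwiner_conj L a ha ha0 b hb hb0 (realDiagonal L dV hdV))
    (splittingOf_isCompatible _ _ _ _ _ _ _ _ _ _ _ _ _ _ _ _ _ hGR)
    (splittingOf_isCompatible _ _ _ _ _ _ _ _ _ _ _ _ _ _ _ _ _ hGR₀)
    (splittingOf_isCompatible _ _ _ _ _ _ _ _ _ _ _ _ _ _ _ _ _ hGR₁)
    (hasThetaMajorants_cmPairSplitting_of_signs_two L e dV hdV hdV0 a ha ha0 ι₁ hGR h₁V h₁W hV)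
    (hasThetaMajorants_omega_pairSmall₁_lineVec_of_signs L e₁ dV hdV hdV0 (b 0) (hb 0) (hb0 0) hGR₀ ι₁ h₁V hV)
    (hasThetaMajorants_omega_pairSmall₂_lineVec_of_signs L e₁ dV hdV hdV0 (b 1) (hb 1) (hb0 1) hGR₁ ι₁ h₁V hV)).comp
      continuous_snd)

/-- **`χ₁′` (conjugated plane) is continuous.** -/
theorem continuous_cmConjLineChar₁_of_signs (ι₁ : L →+* ℂ)
    (h₁V : ∃ i₀ : Fin N, (∀ i, i ≠ i₀ → 0 < (ι₁ (dV i)).re) ∨ ∀ i, i ≠ i₀ → (ι₁ (dV i)).re < 0)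
    (h₁W : (∀ j, 0 < (ι₁ (a j)).re) ∨ ∀ j, (ι₁ (a j)).re < 0)
    (hV : ∀ τ : L →+* ℂ, NumberField.InfinitePlace.mk τ ≠ NumberField.InfinitePlace.mk ι₁ →
      (∀ i, 0 < (τ (dV i)).re) ∨ ∀ i, (τ (dV i)).re < 0) :
    Continuous fun p => ((cmConjLineChar₁ L e e₁ dV hdV hdV0 a ha ha0 b hb hb0 g₀ hg₀ hGR hGR₀ hGR₁ p : ℂˣ) : ℂ) :=
  (continuous_char₄ (↥(NumberField.maximalRealSubfield L)) L (NumberField.IsCMField.complexConj L) N 1 1 e e₁ e₁ (Matrix.diagonal dV)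
    (Matrix.diagonal a) (Matrix.diagonal (lineVec L (b 0))) (Matrix.diagonal (lineVec L (b 1)))
    (complexConj_imagUnit L) (imagUnit_ne_zero L) (imagUnit_mul_self L)
    (realDiagonal_isSymm L dV hdV) (realDiagonal_isSymm L a ha)
    (realDiagonal_isSymm L (lineVec L (b 0)) fun _ => hb 0) (realDiagonal_isSymm L (lineVec L (b 1)) fun _ => hb 1)
    (isUnit_det_realDiagonal L dV hdV hdV0) (isUnit_det_realDiagonal L a ha ha0)
    (isUnit_det_realDiagonal L (lineVec L (b 0)) (fun _ => hb 0) fun _ => hb0 0)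
    (isUnit_det_realDiagonal L (lineVec L (b 1)) (fun _ => hb 1) fun _ => hb0 1)
    ((Matrix.isUnit_iff_isUnit_det _).1
      (isUnit_kronecker_map (↥(NumberField.maximalRealSubfield L)) N (isUnit_det_realDiagonal L dV hdV hdV0)
        (isUnit_det_realDiagonal L a ha ha0)))
    (realDiagonal_map L dV hdV).symm (realDiagonal_map L a ha).symm
    (realDiagonal_map L (lineVec L (b 0)) fun _ => hb 0).symm (realDiagonal_map L (lineVec L (b 1)) fun _ => hb 1).symm
    (Literature.NumberTheory.Automorphic.val_toAdeleGL L g₀) (adelicIsometry_conj L a b g₀ hg₀) (coe_gramConj L a ha ha0 b hb hb0)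
    (gramIntertwiner_conj L a ha ha0 b hb hb0 (realDiagonal L dV hdV))
    (splittingOf_isCompatible _ _ _ _ _ _ _ _ _ _ _ _ _ _ _ _ _ hGR)
    (splittingOf_isCompatible _ _ _ _ _ _ _ _ _ _ _ _ _ _ _ _ _ hGR₀)
    (splittingOf_isCompatible _ _ _ _ _ _ _ _ _ _ _ _ _ _ _ _ _ hGR₁)
    (hasThetaMajorants_cmPairSplitting_of_signs_two L e dV hdV hdV0 a ha ha0 ι₁ hGR h₁V h₁W hV)
    (hasThetaMajorants_omega_pairSmall₁_lineVec_of_signs L e₁ dV hdV hdV0 (b 0) (hb 0) (hb0 0) hGR₀ ι₁ h₁V hV)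
    (hasThetaMajorants_omega_pairSmall₂_lineVec_of_signs L e₁ dV hdV hdV0 (b 1) (hb 1) (hb0 1) hGR₁ ι₁ h₁V hV)).comp
      continuous_snd

end ConjPlane

end CMGeneric

/-! ## §2 The S pin: `slotChiₖ` continuous under plane-definiteness at `ι₁`, hence under any good context -/

section SPin

variable {L : CMField} {ι₁ : L →+* ℂ} (V : HermSpace3 L ι₁) (S : StubTree.SeesawDatum L)
variable
  (hGR : (cmSplittingDatum (L : Type) finProdFinEquiv (frameD V) (frameD_real V) (frameD_ne V) (dW S) (dW_real S) (dW_ne S)).CompatibleSplitting)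
  (hGR₀ : (cmSplittingDatum (L : Type) (e₁) (frameD V) (frameD_real V) (frameD_ne V) (lineVec (L : Type) (dW S 0))
    (fun _ => dW_real S 0) (fun _ => dW_ne S 0)).CompatibleSplitting)
  (hGR₁ : (cmSplittingDatum (L : Type) (e₁) (frameD V) (frameD_real V) (frameD_ne V) (lineVec (L : Type) (dW S 1))
    (fun _ => dW_real S 1) (fun _ => dW_ne S 1)).CompatibleSplitting)
  (hGR₂ : (cmSplittingDatum (L : Type) (e₁) (frameD V) (frameD_real V) (frameD_ne V) (lineVec (L : Type) (dW' S 0))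
    (fun _ => dW'_real S 0) (fun _ => dW'_ne S 0)).CompatibleSplitting)
  (hGR₃ : (cmSplittingDatum (L : Type) (e₁) (frameD V) (frameD_real V) (frameD_ne V) (lineVec (L : Type) (dW' S 1))
    (fun _ => dW'_real S 1) (fun _ => dW'_ne S 1)).CompatibleSplitting)
  (h₁W : (∀ j, 0 < (ι₁ (dW S j)).re) ∨ ∀ j, (ι₁ (dW S j)).re < 0)

/-- `t ↦ (1, u_t · 1_{⟨d⟩})` is continuous. -/
theorem continuous_oneCenterInfUnit (d : (L : Type)) : Continuous (oneCenterInfUnit V d) :=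
  continuous_const.prodMk
    ((continuous_adelicCenter (↥(NumberField.maximalRealSubfield (L : Type))) (L : Type) (NumberField.IsCMField.complexConj L) 1
      (Matrix.diagonal (lineVec (L : Type) d))).comp (continuous_infUnitToOne (L : Type)))

include h₁W in
/-- **`slotChi₀` is continuous** (plane `dW` definite at `ι₁`). -/
theorem continuous_slotChi₀ : Continuous (slotChi₀ V S hGR hGR₀ hGR₁) :=
  (continuous_cmLineChar₀_of_signs (L : Type) finProdFinEquiv e₁ (frameD V) (frameD_real V) (frameD_ne V) (dW S) (dW_real S) (dW_ne S)
    hGR hGR₀ hGR₁ ι₁ (frameD_sign_ι₁' V) h₁W (frameD_sign_of_ne V)).comp (continuous_oneCenterInfUnit V (dW S 0))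

include h₁W in
/-- **`slotChi₁` is continuous.** -/
theorem continuous_slotChi₁ : Continuous (slotChi₁ V S hGR hGR₀ hGR₁) :=
  (continuous_cmLineChar₁_of_signs (L : Type) finProdFinEquiv e₁ (frameD V) (frameD_real V) (frameD_ne V) (dW S) (dW_real S) (dW_ne S)
    hGR hGR₀ hGR₁ ι₁ (frameD_sign_ι₁' V) h₁W (frameD_sign_of_ne V)).comp (continuous_oneCenterInfUnit V (dW S 1))

include h₁W in
/-- **`slotChi₂` is continuous** (conjugated plane; still only `dW`'s definiteness at `ι₁` is used). -/
theorem continuous_slotChi₂ : Continuous (slotChi₂ V S hGR hGR₂ hGR₃) :=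
  (continuous_cmConjLineChar₀_of_signs (L : Type) finProdFinEquiv e₁ (frameD V) (frameD_real V) (frameD_ne V) (dW S) (dW_real S) (dW_ne S)
    hGR (dW' S) (dW'_real S) (dW'_ne S) S.isoGL (isoGL_hg₀ S) hGR₂ hGR₃ ι₁ (frameD_sign_ι₁' V) h₁W (frameD_sign_of_ne V)).comp
    (continuous_oneCenterInfUnit V (dW' S 0))

include h₁W in
/-- **`slotChi₃` is continuous.** -/
theorem continuous_slotChi₃ : Continuous (slotChi₃ V S hGR hGR₂ hGR₃) :=
  (continuous_cmConjLineChar₁_of_signs (L : Type) finProdFinEquiv e₁ (frameD V) (frameD_real V) (frameD_ne V) (dW S) (dW_real S) (dW_ne S)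
    hGR (dW' S) (dW'_real S) (dW'_ne S) S.isoGL (isoGL_hg₀ S) hGR₂ hGR₃ ι₁ (frameD_sign_ι₁' V) h₁W (frameD_sign_of_ne V)).comp
    (continuous_oneCenterInfUnit V (dW' S 1))

include h₁W in
/-- `slotChi₀ · lineC₀` is continuous (the continuity INPUT of `slotType`/`nWOf` at today's eigen-character (F1) `lineC`). -/
theorem continuous_slotChi₀_mul_lineCHom :
    Continuous ⇑(slotChi₀ V S hGR hGR₀ hGR₁ * lineCHom V (dW S 0) (dW_real S 0) (dW_ne S 0) hGR₀) :=
  (continuous_slotChi₀ V S hGR hGR₀ hGR₁ h₁W).mul (continuous_lineCHom V (dW S 0) (dW_real S 0) (dW_ne S 0) hGR₀)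

include h₁W in
/-- `slotChi₁ · lineC₁` is continuous. -/
theorem continuous_slotChi₁_mul_lineCHom :
    Continuous ⇑(slotChi₁ V S hGR hGR₀ hGR₁ * lineCHom V (dW S 1) (dW_real S 1) (dW_ne S 1) hGR₁) :=
  (continuous_slotChi₁ V S hGR hGR₀ hGR₁ h₁W).mul (continuous_lineCHom V (dW S 1) (dW_real S 1) (dW_ne S 1) hGR₁)

include h₁W in
/-- `slotChi₂ · lineC₂` is continuous. -/
theorem continuous_slotChi₂_mul_lineCHom :
    Continuous ⇑(slotChi₂ V S hGR hGR₂ hGR₃ * lineCHom V (dW' S 0) (dW'_real S 0) (dW'_ne S 0) hGR₂) :=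
  (continuous_slotChi₂ V S hGR hGR₂ hGR₃ h₁W).mul (continuous_lineCHom V (dW' S 0) (dW'_real S 0) (dW'_ne S 0) hGR₂)

include h₁W in
/-- `slotChi₃ · lineC₃` is continuous. -/
theorem continuous_slotChi₃_mul_lineCHom :
    Continuous ⇑(slotChi₃ V S hGR hGR₂ hGR₃ * lineCHom V (dW' S 1) (dW'_real S 1) (dW'_ne S 1) hGR₃) :=
  (continuous_slotChi₃ V S hGR hGR₂ hGR₃ h₁W).mul (continuous_lineCHom V (dW' S 1) (dW'_real S 1) (dW'_ne S 1) hGR₃)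

end SPin

/-! ### Under a good context (E's guard): `h₁W` from `dW_definite_of_goodCtx` (#1201) -/

section GoodCtx

variable {L : CMField} {ι₁ : L →+* ℂ} (V : HermSpace3 L ι₁) (c : SeesawCtx L) (h : Bool) (hc : SignRecipe.GoodCtx h ι₁ c)
variable
  (hGR : (cmSplittingDatum (L : Type) finProdFinEquiv (frameD V) (frameD_real V) (frameD_ne V) (dW c.D) (dW_real c.D) (dW_ne c.D)).CompatibleSplitting)
  (hGR₀ : (cmSplittingDatum (L : Type) (e₁) (frameD V) (frameD_real V) (frameD_ne V) (lineVec (L : Type) (dW c.D 0))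
    (fun _ => dW_real c.D 0) (fun _ => dW_ne c.D 0)).CompatibleSplitting)
  (hGR₁ : (cmSplittingDatum (L : Type) (e₁) (frameD V) (frameD_real V) (frameD_ne V) (lineVec (L : Type) (dW c.D 1))
    (fun _ => dW_real c.D 1) (fun _ => dW_ne c.D 1)).CompatibleSplitting)
  (hGR₂ : (cmSplittingDatum (L : Type) (e₁) (frameD V) (frameD_real V) (frameD_ne V) (lineVec (L : Type) (dW' c.D 0))
    (fun _ => dW'_real c.D 0) (fun _ => dW'_ne c.D 0)).CompatibleSplitting)
  (hGR₃ : (cmSplittingDatum (L : Type) (e₁) (frameD V) (frameD_real V) (frameD_ne V) (lineVec (L : Type) (dW' c.D 1))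
    (fun _ => dW'_real c.D 1) (fun _ => dW'_ne c.D 1)).CompatibleSplitting)

include hc in
/-- under `GoodCtx h ι₁ c` (any recipe bit `h`, so also the oriented bit of (ORIENT-h)) the slot-0 character `slotChi₀ · lineC₀` is continuous. -/
theorem continuous_slotChi₀_mul_lineCHom_of_goodCtx :
    Continuous ⇑(slotChi₀ V c.D hGR hGR₀ hGR₁ * lineCHom V (dW c.D 0) (dW_real c.D 0) (dW_ne c.D 0) hGR₀) :=
  continuous_slotChi₀_mul_lineCHom V c.D hGR hGR₀ hGR₁ (dW_definite_of_goodCtx ι₁ c h hc)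

include hc in
/-- … slot 1. -/
theorem continuous_slotChi₁_mul_lineCHom_of_goodCtx :
    Continuous ⇑(slotChi₁ V c.D hGR hGR₀ hGR₁ * lineCHom V (dW c.D 1) (dW_real c.D 1) (dW_ne c.D 1) hGR₁) :=
  continuous_slotChi₁_mul_lineCHom V c.D hGR hGR₀ hGR₁ (dW_definite_of_goodCtx ι₁ c h hc)

include hc in
/-- … slot 2. -/
theorem continuous_slotChi₂_mul_lineCHom_of_goodCtx :
    Continuous ⇑(slotChi₂ V c.D hGR hGR₂ hGR₃ * lineCHom V (dW' c.D 0) (dW'_real c.D 0) (dW'_ne c.D 0) hGR₂) :=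
  continuous_slotChi₂_mul_lineCHom V c.D hGR hGR₂ hGR₃ (dW_definite_of_goodCtx ι₁ c h hc)

include hc in
/-- … slot 3. -/
theorem continuous_slotChi₃_mul_lineCHom_of_goodCtx :
    Continuous ⇑(slotChi₃ V c.D hGR hGR₂ hGR₃ * lineCHom V (dW' c.D 1) (dW'_real c.D 1) (dW'_ne c.D 1) hGR₃) :=
  continuous_slotChi₃_mul_lineCHom V c.D hGR hGR₂ hGR₃ (dW_definite_of_goodCtx ι₁ c h hc)

include hc in
/-- **`nWOf` under a good context IS `μ 0 − slotType₀`** at today's eigen-character `lineC₀` (no continuity input left). -/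
theorem nWOf_eq_of_goodCtx (μ₀ : NumberField.InfinitePlace (L : Type) → ℤ) :
    nWOf V c hGR hGR₀ hGR₁ (lineCHom V (dW c.D 0) (dW_real c.D 0) (dW_ne c.D 0) hGR₀) μ₀ =
      μ₀ - slotType (L := L) (slotChi₀ V c.D hGR hGR₀ hGR₁ * lineCHom V (dW c.D 0) (dW_real c.D 0) (dW_ne c.D 0) hGR₀)
        (continuous_slotChi₀_mul_lineCHom_of_goodCtx V c h hc hGR hGR₀ hGR₁) :=
  nWOf_eq V c hGR hGR₀ hGR₁ _ _ μ₀

end GoodCtx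

/-! ## §3 THE DATUM FROM THE READ-OFF: (F1)'s `archLineDatumOf` with `hμ₀` discharged by the slot-0 normalisation and `hμ₁₂₃` fed by Δ-identities -/

section Assembly

variable
  (χV χW : ∀ {L : CMField} {ι₁ : L →+* ℂ} (_V : HermSpace3 L ι₁) (_c : SeesawCtx L),
    ContinuousMonoidHom (relNormOneIdeles (↥(NumberField.maximalRealSubfield (L : Type))) (L : Type) ⧸
      relNormOneRat (↥(NumberField.maximalRealSubfield (L : Type))) (L : Type)) Circle)
variable {L : CMField} {ι₁ : L →+* ℂ} (V : HermSpace3 L ι₁) (c : SeesawCtx L)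

-- port_pkg: scope closed for this part
end Assembly
end HodgeCM.Model.ArchSideTerm
end
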